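import Summits.QuantumFields.YangMills.Theorems.LuscherReductionTwistedTraceScalingBTGaugeKinetic
import Summits.QuantumFields.YangMills.Theorems.LuscherReductionTwistedTraceScalingInnerStiffForm
import Summits.QuantumFields.YangMills.Theorems.LuscherReductionTwistedTraceScalingGaugeActionLinear
import HarnessLib

/-!
# The DIAGONAL slow dependence of the kinetic phase is «LINEAR IN THE COLOUR VECTORS `c_k = 2u⁰_ku⃗_k` + explicit second order», EXACTLY
# (lane A of S-BASE, crux `TwistedTraceScaling` stmt-QuantumFields-20203, C4-CORE, the (B-T) pen (C); design note `pub/ym-fleet/ym-luscher-20007-p1/COARSE-DESIGN.md` §25.7 (L3))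

The diagonal factor `f(u) = fpBOKernel(u,u)/K₁(u,u)` of the Laplace core is compared with `f(1)` after the colour average `u ↦ cuc⁻¹` (`…BTColourInvariance`, `…BTColourAveraging`).  What the
averaging needs POINTWISE in the fluctuation variable `z = (v, v', g)` is: the phase at `(u,u)` minus the phase at `(1,1)` is a LINEAR functional of the colour vectors `c_k(u) = 2u⁰_k u⃗_k`
plus an explicit second-order term.  For the KINETIC part this is exact quaternion algebra, link by link:
* §1 ★ `re_trace_mul_conj_mul` — `Re tr(A·(uhu⁻¹)·B) = 2(h⁰(BA)⁰ − (Ad(u)h⃗)·(BA)⃗)`; `re_trace_mul_conj_mul_sub` — subtracting the `u = 1` value: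
  `= −2((Ad(u) − 1)h⃗)·(BA)⃗ = −2·c(u)·(h⃗ × (BA)⃗) − 4(u⃗ × (u⃗ × h⃗))·(BA)⃗` (`adRot_mulVec_eq` of `…InnerStiffForm`);
* §2 ★★ `timeCoupling_orthoTube_gauge_diag_sub` — on the tube: `TC(orthoTube u v, g·orthoTube u v') − TC(orthoTube 1 v, g·orthoTube 1 v')
  = −2 Σ_e c_{k}·(g⃗_y × M⃗_e) − 4 Σ_e (u⃗_k × (u⃗_k × g⃗_y))·M⃗_e`, `M_e = chart(v'_e)⁻¹ g_x⁻¹ chart(v_e)` INDEPENDENT of `u` (`e = (x → y)` in direction `k`);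
* §3 the sup-norm bookkeeping: `norm_vecPart_mul_le` (`‖(XY)⃗‖ ≤ ‖X⃗‖ + ‖Y⃗‖ + 2‖X⃗‖‖Y⃗‖`), ★ `norm_vecPart_linkM_le` (`‖M⃗_e‖ ≤ 4(‖v_e‖ + ‖v'_e‖ + ‖g⃗_x‖)` on the cap — `M⃗_e` VANISHES at `z = 0`),
  and the two pointwise bounds ★ `abs_diagKinetic_linear_le` (`≤ 12Σ_e‖c_k‖‖g⃗_y‖‖M⃗_e‖ = O(δ·|z|²)`) and ★ `abs_diagKinetic_second_le` (`≤ 48Σ_e‖u⃗_k‖²‖g⃗_y‖‖M⃗_e‖ = O(δ²|z|²)`):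
  multiplied by `β` on the core `|z| ≤ β^{-1/2}log β` these are `ε₁ = O(δlog²β)` and `ε₂ = O(δ²log²β)` of §25.7, and the linear part averages to ZERO over `c` (`integral_adRot_mulVec_eq_zero`).
HONEST FRAMING: exact algebra for a stub of a child of the CONDITIONAL reduction route R2b1; the Laplace core of (B-T) is OPEN; C4-CORE OPEN; not infinite volume, not a gap, not Clay.
-/

set_option autoImplicit false

noncomputable section

open MeasureTheory Filter Topology Real
open scoped BigOperators Matrix
open Literature.MathematicalPhysics.QuantumFieldTheory
open Literature.MathematicalPhysics.QuantumLattice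

namespace Summit.QuantumFields.YangMills.Theorems.FemtoTransferGap.TwoLattice.ConstTube

open Summit.QuantumFields.YangMills.Theorems.FemtoTransferGap
open Summit.QuantumFields.YangMills.Theorems.FemtoTransferGap.TwoLattice.Cov (scalarPart_inv vecPart_inv adRot_one)
open Summit.QuantumFields.YangMills.Theorems.FemtoTransferGap.TwoLattice.Toron (adRot_mulVec_eq)

variable {L : ℕ} [NeZero L]

/-! ## §1 One link: a conjugated middle factor -/

/-- `Re tr(A·X·B) = 2(X⁰(BA)⁰ − X⃗·(BA)⃗)` (cyclicity + quaternion product). [cite: BrockerTomDieck1985, I (1.10)] -/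
theorem re_trace_mul_mul_eq (A X B : SU2) : ((su2Rep (A * X * B)).trace).re = 2 * (scalarPart X * scalarPart (B * A) - vecPart X ⬝ᵥ vecPart (B * A)) := by
  have h1 : A * X * B = A * (X * (B * A)) * A⁻¹ := by group
  rw [h1, show su2Rep (A * (X * (B * A)) * A⁻¹) = ((A * (X * (B * A)) * A⁻¹ : SU2) : Matrix (Fin 2) (Fin 2) ℂ) from rfl, re_trace_eq_two_mul_scalarPart, scalarPart_conj,
    scalarPart_mul]

/-- ★ **Conjugated middle factor**: `Re tr(A·(uhu⁻¹)·B) = 2(h⁰(BA)⁰ − (Ad(u)h⃗)·(BA)⃗)`. [cite: BrockerTomDieck1985, I (1.10)] -/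
theorem re_trace_mul_conj_mul (A h u B : SU2) :
    ((su2Rep (A * (u * h * u⁻¹) * B)).trace).re = 2 * (scalarPart h * scalarPart (B * A) - (adRot u).mulVec (vecPart h) ⬝ᵥ vecPart (B * A)) := by
  rw [re_trace_mul_mul_eq, scalarPart_conj, vecPart_conj]

/-- `Ad(u)x − x = c(u) × x + 2 u⃗ × (u⃗ × x)` with `c(u) = 2u⁰u⃗`. [cite: BrockerTomDieck1985, I (1.10)] -/
theorem adRot_mulVec_sub_eq (u : SU2) (x : Fin 3 → ℝ) :
    (adRot u).mulVec x - x = ((2 * scalarPart u) • vecPart u) ⨯₃ x + (2 : ℝ) • (vecPart u ⨯₃ (vecPart u ⨯₃ x)) := by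
  rw [adRot_mulVec_eq, LinearMap.map_smul₂]
  abel

/-- ★ **The slow dependence of a conjugated link term**: `Re tr(A(uhu⁻¹)B) − Re tr(AhB) = −2 c(u)·(h⃗ × (BA)⃗) − 4 (u⃗×(u⃗×h⃗))·(BA)⃗`. [folklore] -/
theorem re_trace_mul_conj_mul_sub (A h u B : SU2) :
    ((su2Rep (A * (u * h * u⁻¹) * B)).trace).re - ((su2Rep (A * h * B)).trace).re =
      -(2 * (((2 * scalarPart u) • vecPart u) ⬝ᵥ (vecPart h ⨯₃ vecPart (B * A)))) - 4 * ((vecPart u ⨯₃ (vecPart u ⨯₃ vecPart h)) ⬝ᵥ vecPart (B * A)) := by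
  rw [re_trace_mul_conj_mul, re_trace_mul_mul_eq]
  have h1 : (adRot u).mulVec (vecPart h) ⬝ᵥ vecPart (B * A) - vecPart h ⬝ᵥ vecPart (B * A) = ((adRot u).mulVec (vecPart h) - vecPart h) ⬝ᵥ vecPart (B * A) := by
    rw [sub_dotProduct]
  have h2 : ((adRot u).mulVec (vecPart h) - vecPart h) ⬝ᵥ vecPart (B * A) =
      ((2 * scalarPart u) • vecPart u) ⬝ᵥ (vecPart h ⨯₃ vecPart (B * A)) + 2 * ((vecPart u ⨯₃ (vecPart u ⨯₃ vecPart h)) ⬝ᵥ vecPart (B * A)) := by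
    rw [adRot_mulVec_sub_eq]
    simp only [add_dotProduct, smul_dotProduct, smul_eq_mul, cross_dotProduct_eq]
  linarith [h1, h2]

/-! ## §2 ★★ On the tube: the diagonal kinetic phase -/

omit [NeZero L] in
/-- The link term of `TC(orthoTube u v, g·orthoTube u v')`: `U_e·((g·V)_e)⁻¹ = chart(v_e)·(u_k g_y u_k⁻¹)·(chart(v'_e)⁻¹ g_x⁻¹)`. [folklore] -/
theorem orthoTube_mul_gaugeTransform_orthoTube_inv (u : GaugeConfig 3 1 SU2) (g : Site 3 L → SU2) (v v' : Edge 3 L → Fin 3 → ℝ) (e : Edge 3 L) :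
    orthoTube L u v e * (gaugeTransform g (orthoTube L u v') e)⁻¹ =
      chartSU2 (v e) * (u (0, e.2) * g (e.1.shift e.2) * (u (0, e.2))⁻¹) * ((chartSU2 (v' e))⁻¹ * (g e.1)⁻¹) := by
  simp only [orthoTube_apply, gaugeTransform, mul_inv_rev, inv_inv]
  group

/-- ★★ **The diagonal kinetic phase on the tube minus its value at `u = 1`**, EXACTLY:
`TC(orthoTube u v, g·orthoTube u v') − TC(orthoTube 1 v, g·orthoTube 1 v') = −2Σ_e c_k·(g⃗_y × M⃗_e) − 4Σ_e (u⃗_k×(u⃗_k×g⃗_y))·M⃗_e`, `M_e = chart(v'_e)⁻¹g_x⁻¹chart(v_e)`. [cite: Luscher1983, §3] -/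
theorem timeCoupling_orthoTube_gauge_diag_sub (u : GaugeConfig 3 1 SU2) (g : Site 3 L → SU2) (v v' : Edge 3 L → Fin 3 → ℝ) :
    timeCoupling su2Rep (orthoTube L u v) (gaugeTransform g (orthoTube L u v')) - timeCoupling su2Rep (orthoTube L 1 v) (gaugeTransform g (orthoTube L 1 v')) =
      -(2 * ∑ e : Edge 3 L, ((2 * scalarPart (u (0, e.2))) • vecPart (u (0, e.2))) ⬝ᵥ
          (vecPart (g (e.1.shift e.2)) ⨯₃ vecPart ((chartSU2 (v' e))⁻¹ * (g e.1)⁻¹ * chartSU2 (v e)))) -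
        4 * ∑ e : Edge 3 L, (vecPart (u (0, e.2)) ⨯₃ (vecPart (u (0, e.2)) ⨯₃ vecPart (g (e.1.shift e.2)))) ⬝ᵥ
          vecPart ((chartSU2 (v' e))⁻¹ * (g e.1)⁻¹ * chartSU2 (v e)) := by
  unfold timeCoupling
  rw [← Finset.sum_sub_distrib, Finset.mul_sum, Finset.mul_sum, ← Finset.sum_neg_distrib, ← Finset.sum_sub_distrib]
  refine Finset.sum_congr rfl fun e _ => ?_
  rw [orthoTube_mul_gaugeTransform_orthoTube_inv, orthoTube_mul_gaugeTransform_orthoTube_inv]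
  simp only [Pi.one_apply, one_mul, inv_one, mul_one]
  rw [re_trace_mul_conj_mul_sub]

/-! ## §3 Sup-norm bookkeeping -/

/-- `‖(XY)⃗‖ ≤ ‖X⃗‖ + ‖Y⃗‖ + 2‖X⃗‖‖Y⃗‖` (sup norm). [folklore] -/
theorem norm_vecPart_mul_le (X Y : SU2) : ‖vecPart (X * Y)‖ ≤ ‖vecPart X‖ + ‖vecPart Y‖ + 2 * (‖vecPart X‖ * ‖vecPart Y‖) := by
  rw [vecPart_mul]
  have hX : |scalarPart X| ≤ 1 := abs_scalarPart_le X
  have hY : |scalarPart Y| ≤ 1 := abs_scalarPart_le Y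
  calc ‖scalarPart X • vecPart Y + scalarPart Y • vecPart X + vecPart X ⨯₃ vecPart Y‖
      ≤ ‖scalarPart X • vecPart Y‖ + ‖scalarPart Y • vecPart X‖ + ‖vecPart X ⨯₃ vecPart Y‖ := norm_add₃_le
    _ ≤ ‖vecPart Y‖ + ‖vecPart X‖ + 2 * (‖vecPart X‖ * ‖vecPart Y‖) := by
        refine add_le_add (add_le_add ?_ ?_) (norm_cross_le_two _ _)
        · rw [norm_smul, Real.norm_eq_abs]; exact (mul_le_of_le_one_left (norm_nonneg _) hX)
        · rw [norm_smul, Real.norm_eq_abs]; exact (mul_le_of_le_one_left (norm_nonneg _) hY)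
    _ = ‖vecPart X‖ + ‖vecPart Y‖ + 2 * (‖vecPart X‖ * ‖vecPart Y‖) := by ring

/-- With `‖X⃗‖, ‖Y⃗‖ ≤ 1`: `‖(XY)⃗‖ ≤ 2(‖X⃗‖ + ‖Y⃗‖)`. [folklore] -/
theorem norm_vecPart_mul_le_two (X Y : SU2) : ‖vecPart (X * Y)‖ ≤ 2 * (‖vecPart X‖ + ‖vecPart Y‖) := by
  have h := norm_vecPart_mul_le X Y
  have hX1 : ‖vecPart X‖ ≤ 1 := norm_vecPart_le_one X
  have hY1 : ‖vecPart Y‖ ≤ 1 := norm_vecPart_le_one Y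
  have h3 : ‖vecPart X‖ * ‖vecPart Y‖ ≤ ‖vecPart X‖ := mul_le_of_le_one_right (norm_nonneg _) hY1
  have h4 : ‖vecPart X‖ * ‖vecPart Y‖ ≤ ‖vecPart Y‖ := mul_le_of_le_one_left (norm_nonneg _) hX1
  linarith

/-- ★ **`M⃗_e` is small**: `‖(chart(v')⁻¹·g⁻¹·chart(v))⃗‖ ≤ 4(‖v‖ + ‖v'‖ + ‖g⃗‖)` on the cap. [folklore] -/
theorem norm_vecPart_linkM_le {v v' : Fin 3 → ℝ} (hv : ∑ a, v a ^ 2 ≤ 1) (hv' : ∑ a, v' a ^ 2 ≤ 1) (g : SU2) :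
    ‖vecPart ((chartSU2 v')⁻¹ * g⁻¹ * chartSU2 v)‖ ≤ 4 * (‖v‖ + ‖v'‖ + ‖vecPart g‖) := by
  have h1 := norm_vecPart_mul_le_two ((chartSU2 v')⁻¹ * g⁻¹) (chartSU2 v)
  have h2 := norm_vecPart_mul_le_two (chartSU2 v')⁻¹ g⁻¹
  rw [vecPart_inv, norm_neg, vecPart_inv, norm_neg, vecPart_chartSU2 hv'] at h2
  rw [vecPart_chartSU2 hv] at h1
  nlinarith [norm_nonneg v, norm_nonneg v', norm_nonneg (vecPart g)]

/-- ★ **The linear part is `O(δ·|z|²)` pointwise**: `|2Σ_e c_k·(g⃗_y × M⃗_e)| ≤ 12 Σ_e ‖c_k‖·‖g⃗_y‖·‖M⃗_e‖`. [folklore] -/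
theorem abs_diagKinetic_linear_le (c : Fin 3 → Fin 3 → ℝ) (p M : Edge 3 L → Fin 3 → ℝ) :
    |2 * ∑ e : Edge 3 L, c e.2 ⬝ᵥ (p e ⨯₃ M e)| ≤ 12 * ∑ e : Edge 3 L, ‖c e.2‖ * ‖p e‖ * ‖M e‖ := by
  have hterm : ∀ e : Edge 3 L, |c e.2 ⬝ᵥ (p e ⨯₃ M e)| ≤ 6 * (‖c e.2‖ * ‖p e‖ * ‖M e‖) := fun e => by
    have h1 := abs_dotProduct_le_three (c e.2) (p e ⨯₃ M e)
    have h2 := norm_cross_le_two (p e) (M e)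
    have h0 : 0 ≤ ‖c e.2‖ := norm_nonneg _
    nlinarith [mul_le_mul_of_nonneg_left h2 h0]
  calc |2 * ∑ e : Edge 3 L, c e.2 ⬝ᵥ (p e ⨯₃ M e)| = 2 * |∑ e : Edge 3 L, c e.2 ⬝ᵥ (p e ⨯₃ M e)| := by rw [abs_mul, abs_two]
    _ ≤ 2 * ∑ e : Edge 3 L, |c e.2 ⬝ᵥ (p e ⨯₃ M e)| := by gcongr; exact Finset.abs_sum_le_sum_abs _ _
    _ ≤ 2 * ∑ e : Edge 3 L, 6 * (‖c e.2‖ * ‖p e‖ * ‖M e‖) := by gcongr with e; exact hterm e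
    _ = 12 * ∑ e : Edge 3 L, ‖c e.2‖ * ‖p e‖ * ‖M e‖ := by rw [← Finset.mul_sum]; ring

/-- ★ **The second-order part is `O(δ²·|z|²)` pointwise**: `|4Σ_e (u⃗_k×(u⃗_k×g⃗_y))·M⃗_e| ≤ 48 Σ_e ‖u⃗_k‖²·‖g⃗_y‖·‖M⃗_e‖`. [folklore] -/
theorem abs_diagKinetic_second_le (a : Fin 3 → Fin 3 → ℝ) (p M : Edge 3 L → Fin 3 → ℝ) :
    |4 * ∑ e : Edge 3 L, (a e.2 ⨯₃ (a e.2 ⨯₃ p e)) ⬝ᵥ M e| ≤ 48 * ∑ e : Edge 3 L, ‖a e.2‖ ^ 2 * ‖p e‖ * ‖M e‖ := by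
  have hterm : ∀ e : Edge 3 L, |(a e.2 ⨯₃ (a e.2 ⨯₃ p e)) ⬝ᵥ M e| ≤ 12 * (‖a e.2‖ ^ 2 * ‖p e‖ * ‖M e‖) := fun e => by
    have h1 := abs_dotProduct_le_three (a e.2 ⨯₃ (a e.2 ⨯₃ p e)) (M e)
    have h2 := norm_cross_le_two (a e.2) (a e.2 ⨯₃ p e)
    have h3 := norm_cross_le_two (a e.2) (p e)
    have h0 : 0 ≤ ‖a e.2‖ := norm_nonneg _
    have h4 : ‖a e.2 ⨯₃ (a e.2 ⨯₃ p e)‖ ≤ 4 * (‖a e.2‖ ^ 2 * ‖p e‖) := by nlinarith [mul_le_mul_of_nonneg_left h3 h0]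
    nlinarith [mul_le_mul_of_nonneg_right h4 (norm_nonneg (M e))]
  calc |4 * ∑ e : Edge 3 L, (a e.2 ⨯₃ (a e.2 ⨯₃ p e)) ⬝ᵥ M e| = 4 * |∑ e : Edge 3 L, (a e.2 ⨯₃ (a e.2 ⨯₃ p e)) ⬝ᵥ M e| := by
        rw [abs_mul, show |(4 : ℝ)| = 4 by norm_num]
    _ ≤ 4 * ∑ e : Edge 3 L, |(a e.2 ⨯₃ (a e.2 ⨯₃ p e)) ⬝ᵥ M e| := by gcongr; exact Finset.abs_sum_le_sum_abs _ _
    _ ≤ 4 * ∑ e : Edge 3 L, 12 * (‖a e.2‖ ^ 2 * ‖p e‖ * ‖M e‖) := by gcongr with e; exact hterm e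
    _ = 48 * ∑ e : Edge 3 L, ‖a e.2‖ ^ 2 * ‖p e‖ * ‖M e‖ := by rw [← Finset.mul_sum]; ring

end Summit.QuantumFields.YangMills.Theorems.FemtoTransferGap.TwoLattice.ConstTube

end
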